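import Summits.CriticalPhenomena.PercolationContinuityZ3.Theorems.FK.Transplant.FHSlabThresholdStrict
import Summits.CriticalPhenomena.PercolationContinuityZ3.Theorems.FK.Transplant.FHSlabThresholdGap
import HarnessLib

/-!
# FRONTIER TRANSPLANT, binder 1 (FH) calibration — FBN-01's slab threshold `p̂_c(q)` is STRICTLY increasing in `q`
# on `[1, ∞)` (`d ≥ 2`), with the rate `p̂_c(q₁) - p̂_c(q₂) ≥ (q₁-q₂)·p̂_c(q₁)(1-p̂_c(q₁))^{2d}/(8dq₁)`: the free
# slab-box connectivities `φ⁰_{S(L,N),p,q}(0 ↔ x)` obey the segment comparison of `QComparisonSegment` (no wiring)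

Registered R71 (cell INBOX l.5302, 2026-08-23); registry row T1m; label T1m-G (coordinator fk-4 g139; adopted by the lead, L45 l.5303 = typer read NO OBJECTION at the statement layer); placement R71 (δ): all seven files of this package live under `Theorems/FK/Transplant/` (own-chain imports re-pointed; statements untouched).
Support file (`--supports stmt-CriticalPhenomena-4575`, helper) of the FRONTIER TRANSPLANT sub-cell
(`fk-continuity/transplant/`, seat `prim-bschramm-fkt-p2`); builds on p205010 (kernel theorem, internal audit signed;
external expert review pending). No definitions, no named facts, no sorries; standard axioms. Sequel of
`Transplant/FHSlabThresholdMono.lean` (T1q-A: `p̂_c` monotone and `1/4`-Lipschitz in `q`), of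
`Transplant/FHSlabThresholdStrict.lean` and of `Theorems/FK/QComparisonSegment.lean`.

HONEST FRAMING (page 1, cell rule). The transplant's theorem of record `ufsc0_of_freeBoundaryHypothesis_r3`
(p248245, « 2 / 0 ☑ ») is CONDITIONAL on FH AND on TP_FK, both OPEN at the same `p` for `q > 1` near `p_c(q)`
(⇔ GRC Conj. (5.103) via K1; barrier note `Literature.Barriers.CriticalPhenomena.SamePFreeBoundaryCriteria`, FBN-01);
the transplant is a typed reduction, not a proof of FK continuity. THIS FILE DOES NOT CHANGE THAT; it is
UNCONDITIONAL: BOTH end points of the K1 interval `[p_c(q), p̂_c(q)]` are strictly increasing in `q`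
(`strictMonoOn_rcCriticalProb` of `CriticalPointStrictMono`, `strictMonoOn_fkSlabCriticalProb` here), because the
comparison theorem `rcMeasure_real_le_of_slope` needs no wiring: on the slab box `S(L, N)` with the FREE measure
(`B = ∅`, every vertex of degree `≤ 2d`) it compares `φ⁰_{S(L,N),p₁,q₁}(0 ↔ x) ≤ φ⁰_{S(L,N),p₂,q₂}(0 ↔ x)` along the
admissible segments `4dq₁(p₁-p₂) ≤ (q₁-q₂)p₂(1-p₁)^{2d}`, hence transports Grimmett's `Π(p, L)` from `(p₁, q₁)` to
`(p₂, q₂)`. Nothing is claimed about `p̂_c(q) = p_c(q)` for `q > 1`; not a binder discharge, not a re-cut, not `_r4`;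
`_r3` « 2 / 0 ☑ », n_open = 2, BINDER-OWNERS, FO-19 NO-GO unchanged.

## Contents (namespace `Summit.CriticalPhenomena.PercolationContinuityZ3.Theorems.FK`)

`finsetGraph_zdGraph_degree_le`, **`fkSlabConnectivity_le_of_slope`**, **`fkSlabPercolation_of_slope`** (`Π(p₁, L)` at
`q₁` gives `Π(p₂, L)` at `q₂` along admissible segments), **`fkSlabCriticalProb_sub_ge`** (the rate),
**`fkSlabCriticalProb_lt_of_lt`**, **`strictMonoOn_fkSlabCriticalProb`**, `injOn_fkSlabCriticalProb`.

## References

* G. Grimmett, *The Random-Cluster Model*, Springer 2006: Thm. (3.24), Prop. (3.28); §5.7 (5.102), Conj. (5.103);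
  Thm. (5.10). [Grimmett2006]
* F. Severo, ECP 29 (2024), §1 (definition of `p̂_c`). [Severo2024]
-/

noncomputable section

open scoped Classical
open Filter Topology

namespace Summit.CriticalPhenomena.PercolationContinuityZ3.Theorems.FK

open Literature.Probability.Percolation Literature.Probability.LatticeModels
open Literature.Barriers.CriticalPhenomena

variable {d : ℕ}

/-- Every vertex of an induced subgraph of `ℤ^d` has degree at most `2d`. [cite: Grimmett2006, proof of Thm. (5.10) p. 101 ("deg(W) = 2d")] -/
theorem finsetGraph_zdGraph_degree_le (S : Finset (Site d)) (x : ↥S) : (finsetGraph (zdGraph d) S).degree x ≤ 2 * d := by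
  rw [← card_neighborFinset_zdGraph_holds (x : Site d), ← SimpleGraph.card_neighborFinset_eq_degree]
  refine Finset.card_le_card_of_injOn Subtype.val (fun z hz => ?_) (Set.injOn_of_injective Subtype.val_injective)
  rw [Finset.mem_coe, SimpleGraph.mem_neighborFinset] at hz ⊢
  exact hz

/-- **Free slab-box connectivities along admissible segments**: for `d ≥ 1`, `1 ≤ q₂ ≤ q₁`, `0 < p₂ ≤ p₁ < 1` with
`4dq₁(p₁-p₂) ≤ (q₁-q₂)p₂(1-p₁)^{2d}`: `φ⁰_{S(L,N),p₁,q₁}(0 ↔ x) ≤ φ⁰_{S(L,N),p₂,q₂}(0 ↔ x)` for all `L, N, x`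
(`rcMeasure_real_le_of_slope` with no wired vertex). [cite: Grimmett2006, Thm. (3.24) eq. (3.25) and §5.7 (ψ^{L,n}_{p,q}(0 ↔ x))] -/
theorem fkSlabConnectivity_le_of_slope (hd : 1 ≤ d) {p₁ p₂ q₁ q₂ : ℝ} (hq₂ : 1 ≤ q₂) (hq : q₂ ≤ q₁)
    (hp₂ : 0 < p₂) (hp : p₂ ≤ p₁) (hp₁ : p₁ < 1)
    (hslope : 4 * d * q₁ * (p₁ - p₂) ≤ (q₁ - q₂) * p₂ * (1 - p₁) ^ (2 * d)) (L N : ℕ) (x : FKSlabV d L N) :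
    fkSlabConnectivity d p₁ q₁ L N x ≤ fkSlabConnectivity d p₂ q₂ L N x := by
  unfold fkSlabConnectivity
  refine rcMeasure_real_le_of_slope hq₂ hq hp₂ hp hp₁ (∅ : Set (FKSlabV d L N)) (Δ := 2 * d) (by omega)
    (fun y _ => finsetGraph_zdGraph_degree_le (fkSlab d L N) y) ?_ (isUpperSet_fkSlabJoined d L N x) ?_
  · push_cast
    linarith
  · intro ω e he heB
    induction e using Sym2.ind with
    | h u v => exact absurd (heB u (Sym2.mem_mk_left u v)) (Set.notMem_empty u)

/-- **`Π(p, L)` travels along admissible segments**: under the hypotheses of `fkSlabConnectivity_le_of_slope`,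
free slab percolation at `(p₁, q₁)` implies free slab percolation at `(p₂, q₂)` with the same width and the same `α`.
[cite: Grimmett2006, §5.7 (the property Π(p, L)) and Thm. (3.24)] -/
theorem fkSlabPercolation_of_slope (hd : 1 ≤ d) {p₁ p₂ q₁ q₂ : ℝ} (hq₂ : 1 ≤ q₂) (hq : q₂ ≤ q₁)
    (hp₂ : 0 < p₂) (hp : p₂ ≤ p₁) (hp₁ : p₁ < 1)
    (hslope : 4 * d * q₁ * (p₁ - p₂) ≤ (q₁ - q₂) * p₂ * (1 - p₁) ^ (2 * d)) {L : ℕ}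
    (h : FKSlabPercolation d p₁ q₁ L) : FKSlabPercolation d p₂ q₂ L := by
  obtain ⟨α, hα, hlt⟩ := h
  exact ⟨α, hα, fun N x => (hlt N x).trans_le (fkSlabConnectivity_le_of_slope hd hq₂ hq hp₂ hp hp₁ hslope L N x)⟩

/-- **Quantitative strict monotonicity of the slab threshold in `q`**: for `d ≥ 2` and `1 ≤ q₂ ≤ q₁`,
`p̂_c(q₁) - p̂_c(q₂) ≥ (q₁ - q₂) · p̂_c(q₁)(1 - p̂_c(q₁))^{2d} / (8dq₁)` (FBN-01's `fkSlabCriticalProb`). Proof as for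
`rcCriticalProb_sub_ge`: above `p̂_c(q₁)` some `Π(p₁, L)` holds at `q₁`, hence `Π(p₂, L)` at `q₂` with
`p₂ = p₁ - (q₁-q₂)p₁(1-p₁)^{2d}/(8dq₁)`, so `p̂_c(q₂) ≤ p₂`; let `p₁ ↓ p̂_c(q₁)`.
[cite: Grimmett2006, Thm. (5.10) and §5.7 eq. (5.102)] [cite: Severo2024, §1 (definition of p̂_c)] -/
theorem fkSlabCriticalProb_sub_ge (hd : 2 ≤ d) {q₁ q₂ : ℝ} (hq₂ : 1 ≤ q₂) (hq : q₂ ≤ q₁) :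
    (q₁ - q₂) * (fkSlabCriticalProb d q₁ * (1 - fkSlabCriticalProb d q₁) ^ (2 * d)) / (8 * d * q₁) ≤
      fkSlabCriticalProb d q₁ - fkSlabCriticalProb d q₂ := by
  have hq₁ : 1 ≤ q₁ := hq₂.trans hq
  have hq₁0 : 0 < q₁ := one_pos.trans_le hq₁
  have hd1 : 1 ≤ d := le_of_lt hd
  have hdr : (0 : ℝ) < d := Nat.cast_pos.2 (by omega)
  set c := fkSlabCriticalProb d q₁ with hc
  have hcI : c ∈ Set.Ioo (0 : ℝ) 1 := fkSlabCriticalProb_mem_Ioo hd hq₁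
  set g : ℝ → ℝ := fun p => p - (q₁ - q₂) * (p * (1 - p) ^ (2 * d)) / (8 * d * q₁) with hg
  have hbound : ∀ p₁ ∈ Set.Ioo c 1, fkSlabCriticalProb d q₂ ≤ g p₁ := by
    intro p₁ hp₁
    have hp₁0 : 0 < p₁ := hcI.1.trans hp₁.1
    set δ := (q₁ - q₂) * (p₁ * (1 - p₁) ^ (2 * d)) / (8 * d * q₁) with hδ
    have hδ0 : 0 ≤ δ := by
      have : 0 ≤ (1 - p₁) ^ (2 * d) := pow_nonneg (sub_nonneg.2 hp₁.2.le) _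
      have : 0 ≤ (q₁ - q₂) * (p₁ * (1 - p₁) ^ (2 * d)) :=
        mul_nonneg (sub_nonneg.2 hq) (mul_nonneg hp₁0.le this)
      positivity
    have hδle : δ ≤ p₁ / 2 := by
      have h1 : (1 - p₁) ^ (2 * d) ≤ 1 := pow_le_one₀ (sub_nonneg.2 hp₁.2.le) (sub_le_self 1 hp₁0.le)
      have h2 : (q₁ - q₂) * (p₁ * (1 - p₁) ^ (2 * d)) ≤ q₁ * p₁ := by
        have : (q₁ - q₂) ≤ q₁ := by linarith
        calc (q₁ - q₂) * (p₁ * (1 - p₁) ^ (2 * d)) ≤ q₁ * (p₁ * (1 - p₁) ^ (2 * d)) :=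
              mul_le_mul_of_nonneg_right this (mul_nonneg hp₁0.le (pow_nonneg (sub_nonneg.2 hp₁.2.le) _))
          _ ≤ q₁ * (p₁ * 1) := mul_le_mul_of_nonneg_left (mul_le_mul_of_nonneg_left h1 hp₁0.le) hq₁0.le
          _ = q₁ * p₁ := by ring
      have hd1r : (1 : ℝ) ≤ d := by exact_mod_cast hd1
      have h3 : 0 ≤ q₁ * p₁ * (4 * d - 1) := mul_nonneg (mul_pos hq₁0 hp₁0).le (by linarith)
      rw [hδ, div_le_iff₀ (by positivity)]
      nlinarith [h2, h3]
    have hp₂0 : 0 < p₁ - δ := by linarith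
    have hp₂le : p₁ - δ ≤ p₁ := by linarith
    have hslope : 4 * d * q₁ * (p₁ - (p₁ - δ)) ≤ (q₁ - q₂) * (p₁ - δ) * (1 - p₁) ^ (2 * d) := by
      have e : 4 * d * q₁ * (p₁ - (p₁ - δ)) = (q₁ - q₂) * (p₁ / 2) * (1 - p₁) ^ (2 * d) := by
        rw [hδ]
        field_simp
        ring
      rw [e]
      have : 0 ≤ (q₁ - q₂) * (1 - p₁) ^ (2 * d) :=
        mul_nonneg (sub_nonneg.2 hq) (pow_nonneg (sub_nonneg.2 hp₁.2.le) _)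
      nlinarith
    obtain ⟨L, hL⟩ := exists_fkSlabPercolation_of_fkSlabCriticalProb_lt hq₁ ⟨hp₁0.le, hp₁.2.le⟩ hp₁.1
    have hL₂ := fkSlabPercolation_of_slope hd1 hq₂ hq hp₂0 hp₂le hp₁.2 hslope hL
    have := fkSlabCriticalProb_le_of_fkSlabPercolation ⟨hp₂0.le, hp₂le.trans hp₁.2.le⟩ hL₂
    simpa [hg, hδ] using this
  have hcont : Tendsto g (𝓝[>] c) (𝓝 (g c)) := by
    have : Continuous g := by
      rw [hg]
      fun_prop
    exact (this.tendsto c).mono_left nhdsWithin_le_nhds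
  have hev : ∀ᶠ p₁ in 𝓝[>] c, fkSlabCriticalProb d q₂ ≤ g p₁ :=
    eventually_of_mem (Ioo_mem_nhdsGT hcI.2) hbound
  have hle : fkSlabCriticalProb d q₂ ≤ g c := ge_of_tendsto hcont hev
  simp only [hg] at hle
  linarith

/-- **`p̂_c(q)` is STRICTLY increasing in `q` on `[1, ∞)`, `d ≥ 2`** (for FBN-01's `fkSlabCriticalProb`; the
monotone / Lipschitz halves are T1q-A `fkSlabCriticalProb_mono` / `lipschitzOnWith_fkSlabCriticalProb`).
[cite: Grimmett2006, §5.7 eq. (5.102) with Thm. (3.24)] [cite: Severo2024, §1 (definition of p̂_c)] -/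
theorem fkSlabCriticalProb_lt_of_lt (hd : 2 ≤ d) {q₁ q₂ : ℝ} (hq₂ : 1 ≤ q₂) (hq : q₂ < q₁) :
    fkSlabCriticalProb d q₂ < fkSlabCriticalProb d q₁ := by
  have h := fkSlabCriticalProb_sub_ge hd hq₂ hq.le
  have hcI : fkSlabCriticalProb d q₁ ∈ Set.Ioo (0 : ℝ) 1 := fkSlabCriticalProb_mem_Ioo hd (hq₂.trans hq.le)
  have hdr : (0 : ℝ) < d := Nat.cast_pos.2 (by omega)
  have hpos : 0 < (q₁ - q₂) * (fkSlabCriticalProb d q₁ * (1 - fkSlabCriticalProb d q₁) ^ (2 * d)) / (8 * d * q₁) := by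
    have : 0 < 1 - fkSlabCriticalProb d q₁ := sub_pos.2 hcI.2
    have hq₁ : 0 < q₁ := one_pos.trans_le (hq₂.trans hq.le)
    have : 0 < q₁ - q₂ := sub_pos.2 hq
    have := hcI.1
    positivity
  linarith

/-- `p̂_c` is strictly monotone on `[1, ∞)` (`d ≥ 2`). [cite: Grimmett2006, §5.7 eq. (5.102) with Thm. (3.24)] -/
theorem strictMonoOn_fkSlabCriticalProb (hd : 2 ≤ d) : StrictMonoOn (fkSlabCriticalProb d) (Set.Ici 1) :=
  fun _ hq₂ _ _ hlt => fkSlabCriticalProb_lt_of_lt hd hq₂ hlt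

/-- `p̂_c` is injective on `[1, ∞)` (`d ≥ 2`). [cite: Grimmett2006, §5.7 eq. (5.102) with Thm. (3.24)] -/
theorem injOn_fkSlabCriticalProb (hd : 2 ≤ d) : Set.InjOn (fkSlabCriticalProb d) (Set.Ici 1) :=
  (strictMonoOn_fkSlabCriticalProb hd).injOn

end Summit.CriticalPhenomena.PercolationContinuityZ3.Theorems.FK

end
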